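import Mathlib

/-!
# KPlusLogSqLawResolvedSmallBlocks — the small-block parity law (all `N`, no distinctness)

Resolved (tropical, α-row) side of the K + log² programme, cf. the route items
`Theses.KPlusLogSqLaw.DComb` / `ClosedWindowLaw` (stmt-ValiantsHypothesis-28100 / 28101).

**Theorem (`odd_steps_le_of_small_blocks`).** Let `lam : Fin N → ℤ` be a two-speed word
(`lam e ∈ {1, -1, 2, -2}`) and `μ₀, …, μ_L` ANY finite sets of edges (`Finset (Fin N)`) whose
slopes `∑ e ∈ μ_k, lam e` strictly increase.  If every step set `μ_k ∆ μ_{k+1}` has at most four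
elements (or exactly six), then the number of steps with `|μ_k ∆ μ_{k+1}|` odd is at most `N`.

No matching structure, no consecutiveness of blocks and no distinctness hypothesis is needed:
the whole difficulty of the parity law `D^comb` therefore sits in blocks of size 5 and ≥ 7
(the "conversion blocks"; hub-exact data in the seat notes of pub-symmetroid-conjb-2 g18).

*Proof.*  Sign potential `Ψ(S) = ∑ e ∈ S, sign (lam e)`.  For one step with `P = A ∆ B`,
`gain = ∑_{e ∈ P} c_e` and `Ψ B - Ψ A = ∑_{e ∈ P} d_e` where `c_e = ±lam e`, `d_e = ±sign (lam e)`
(`+` on `B \ A`, `-` on `A \ B`); pointwise `2 c_e ≤ 3 d_e + 1` and `d_e = 2 t_e - 1` with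
`t_e ∈ {0,1}`, hence `2 ≤ 2·gain ≤ 6 T - 2 |P|` and `Ψ B - Ψ A = 2 T - |P| ≥ [|P| odd]` whenever
`|P| ≤ 4` or `|P| = 6`.  Telescoping, `#odd ≤ Ψ(μ_L) - Ψ(μ_0) ≤ #{lam > 0} + #{lam < 0} ≤ N`. ∎
-/

set_option linter.dupNamespace false

namespace Summit.ValiantsHypothesis.ValiantsHypothesis.Theorems.KPlusLogSqLaw.ResolvedSmallBlocks

open Finset

variable {N : ℕ}

/-- A difference of sums over two finite sets is a signed sum over their symmetric difference. -/
theorem sum_sub_sum_eq_symmDiff (f : Fin N → ℤ) (A B : Finset (Fin N)) :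
    ∑ e ∈ B, f e - ∑ e ∈ A, f e = ∑ e ∈ symmDiff A B, (if e ∈ B then f e else -f e) := by
  rw [← Finset.sum_sdiff_sub_sum_sdiff]
  have hdisj : Disjoint (A \ B) (B \ A) := by
    rw [Finset.disjoint_left]
    intro x hx hx'
    simp only [Finset.mem_sdiff] at hx hx'
    exact hx.2 hx'.1
  have hsd : symmDiff A B = (A \ B) ∪ (B \ A) := rfl
  rw [hsd, Finset.sum_union hdisj]
  have h1 : ∑ e ∈ A \ B, (if e ∈ B then f e else -f e) = -∑ e ∈ A \ B, f e := by
    rw [← Finset.sum_neg_distrib]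
    apply Finset.sum_congr rfl
    intro e he
    simp only [Finset.mem_sdiff] at he
    simp [he.2]
  have h2 : ∑ e ∈ B \ A, (if e ∈ B then f e else -f e) = ∑ e ∈ B \ A, f e := by
    apply Finset.sum_congr rfl
    intro e he
    simp only [Finset.mem_sdiff] at he
    simp [he.1]
  rw [h1, h2]
  ring

/-- One step: if the slope strictly increases and `|A ∆ B| ≤ 4` or `= 6`, the sign potential
increases by at least `[ |A ∆ B| odd ]`. -/
theorem psi_step (lam : Fin N → ℤ) (hlam : ∀ e, lam e = 1 ∨ lam e = -1 ∨ lam e = 2 ∨ lam e = -2)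
    (A B : Finset (Fin N)) (hgain : ∑ e ∈ A, lam e < ∑ e ∈ B, lam e)
    (hsmall : (symmDiff A B).card ≤ 4 ∨ (symmDiff A B).card = 6) :
    (if Odd (symmDiff A B).card then (1 : ℤ) else 0) ≤
      ∑ e ∈ B, Int.sign (lam e) - ∑ e ∈ A, Int.sign (lam e) := by
  set P := symmDiff A B with hP
  -- the step functions
  let c : Fin N → ℤ := fun e => if e ∈ B then lam e else -lam e
  let d : Fin N → ℤ := fun e => if e ∈ B then Int.sign (lam e) else -Int.sign (lam e)
  let t : Fin N → ℤ := fun e => if d e = 1 then 1 else 0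
  have hgain' : 1 ≤ ∑ e ∈ P, c e := by
    have := sum_sub_sum_eq_symmDiff lam A B
    simp only [hP]
    linarith
  have hdelta : ∑ e ∈ B, Int.sign (lam e) - ∑ e ∈ A, Int.sign (lam e) = ∑ e ∈ P, d e := by
    rw [sum_sub_sum_eq_symmDiff]
  -- pointwise facts
  have s2 : Int.sign 2 = 1 := by decide
  have hpt : ∀ e, 2 * c e ≤ 3 * d e + 1 ∧ d e = 2 * t e - 1 := by
    intro e
    rcases hlam e with h | h | h | h <;>
      by_cases hb : e ∈ B <;> simp [c, d, t, h, hb, s2]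
  have hsum1 : 2 * ∑ e ∈ P, c e ≤ 3 * ∑ e ∈ P, d e + P.card := by
    have : ∑ e ∈ P, 2 * c e ≤ ∑ e ∈ P, (3 * d e + 1) :=
      Finset.sum_le_sum fun e _ => (hpt e).1
    rw [← Finset.mul_sum] at this
    rw [Finset.sum_add_distrib, ← Finset.mul_sum, Finset.sum_const, nsmul_eq_mul, mul_one] at this
    linarith
  have hsum2 : ∑ e ∈ P, d e = 2 * ∑ e ∈ P, t e - P.card := by
    have : ∑ e ∈ P, d e = ∑ e ∈ P, (2 * t e - 1) := Finset.sum_congr rfl fun e _ => (hpt e).2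
    rw [this, Finset.sum_sub_distrib, ← Finset.mul_sum, Finset.sum_const, nsmul_eq_mul, mul_one]
  have ht0 : ∀ e, 0 ≤ t e := by intro e; simp only [t]; split_ifs <;> norm_num
  have hT : 0 ≤ ∑ e ∈ P, t e := Finset.sum_nonneg fun e _ => ht0 e
  rw [hdelta, hsum2]
  set T := ∑ e ∈ P, t e with hT'
  set ℓ := P.card with hℓ
  have key : (ℓ : ℤ) + 1 ≤ 3 * T := by
    have := hsum1
    rw [hsum2] at this
    linarith
  rcases hsmall with h4 | h6
  · by_cases ho : Odd ℓ
    · rw [if_pos ho]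
      obtain ⟨j, hj⟩ := ho
      push_cast [hj] at key ⊢
      omega
    · rw [if_neg ho]
      omega
  · have ho : ¬ Odd ℓ := by rw [h6]; decide
    rw [if_neg ho]
    push_cast [h6] at key ⊢
    omega

/-- Range of the sign potential `Ψ(S) = ∑_{e ∈ S} sign (lam e)`: `Ψ(S') - Ψ(S) ≤ N`. -/
theorem psi_sub_psi_le (lam : Fin N → ℤ) (S S' : Finset (Fin N)) :
    ∑ e ∈ S', Int.sign (lam e) - ∑ e ∈ S, Int.sign (lam e) ≤ N := by
  have h1 : ∑ e ∈ S', Int.sign (lam e) ≤ ((Finset.univ.filter fun e : Fin N => 0 < lam e).card : ℤ) := by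
    calc ∑ e ∈ S', Int.sign (lam e) ≤ ∑ e ∈ S', (if 0 < lam e then (1 : ℤ) else 0) := by
          apply Finset.sum_le_sum
          intro e _
          rcases lt_trichotomy (lam e) 0 with h | h | h
          · rw [Int.sign_eq_neg_one_of_neg h, if_neg (not_lt.mpr h.le)]; norm_num
          · simp [h]
          · rw [Int.sign_eq_one_of_pos h, if_pos h]
      _ ≤ ∑ e ∈ (Finset.univ : Finset (Fin N)), (if 0 < lam e then (1 : ℤ) else 0) := by
          apply Finset.sum_le_sum_of_subset_of_nonneg (Finset.subset_univ _)
          intro e _ _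
          split_ifs <;> norm_num
      _ = ((Finset.univ.filter fun e : Fin N => 0 < lam e).card : ℤ) := by
          rw [Finset.sum_ite, Finset.sum_const_zero, add_zero, Finset.sum_const, nsmul_eq_mul, mul_one]
  have h2 : -∑ e ∈ S, Int.sign (lam e) ≤ ((Finset.univ.filter fun e : Fin N => ¬ 0 < lam e).card : ℤ) := by
    rw [← Finset.sum_neg_distrib]
    calc ∑ e ∈ S, -Int.sign (lam e) ≤ ∑ e ∈ S, (if ¬ 0 < lam e then (1 : ℤ) else 0) := by
          apply Finset.sum_le_sum
          intro e _
          rcases lt_trichotomy (lam e) 0 with h | h | h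
          · rw [Int.sign_eq_neg_one_of_neg h, if_pos (not_lt.mpr h.le)]; norm_num
          · simp [h]
          · rw [Int.sign_eq_one_of_pos h, if_neg (not_not.mpr h)]; norm_num
      _ ≤ ∑ e ∈ (Finset.univ : Finset (Fin N)), (if ¬ 0 < lam e then (1 : ℤ) else 0) := by
          apply Finset.sum_le_sum_of_subset_of_nonneg (Finset.subset_univ _)
          intro e _ _
          split_ifs <;> norm_num
      _ = ((Finset.univ.filter fun e : Fin N => ¬ 0 < lam e).card : ℤ) := by
          rw [Finset.sum_ite, Finset.sum_const_zero, add_zero, Finset.sum_const, nsmul_eq_mul, mul_one]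
  have h3 : (Finset.univ.filter fun e : Fin N => 0 < lam e).card +
      (Finset.univ.filter fun e : Fin N => ¬ 0 < lam e).card = N := by
    rw [Finset.card_filter_add_card_filter_not, Finset.card_univ, Fintype.card_fin]
  have h3' : ((Finset.univ.filter fun e : Fin N => 0 < lam e).card : ℤ) +
      ((Finset.univ.filter fun e : Fin N => ¬ 0 < lam e).card : ℤ) = N := by exact_mod_cast h3
  linarith

/-- **Small-block parity law.** For a two-speed word and ANY chain of edge sets with strictly
increasing slopes whose steps change at most four (or exactly six) edges, the number of steps
changing an odd number of edges is at most `N`. -/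
theorem odd_steps_le_of_small_blocks (N L : ℕ) (lam : Fin N → ℤ) (μ : Fin (L + 1) → Finset (Fin N))
    (hlam : ∀ e, lam e = 1 ∨ lam e = -1 ∨ lam e = 2 ∨ lam e = -2)
    (hslope : ∀ k : Fin L, ∑ e ∈ μ k.castSucc, lam e < ∑ e ∈ μ k.succ, lam e)
    (hsmall : ∀ k : Fin L, (symmDiff (μ k.castSucc) (μ k.succ)).card ≤ 4 ∨
      (symmDiff (μ k.castSucc) (μ k.succ)).card = 6) :
    (Finset.univ.filter fun k : Fin L => Odd (symmDiff (μ k.castSucc) (μ k.succ)).card).card ≤ N := by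
  -- #odd as a sum of indicators, bounded by the telescoping sum of Ψ-increments
  have hcount : ((Finset.univ.filter fun k : Fin L =>
      Odd (symmDiff (μ k.castSucc) (μ k.succ)).card).card : ℤ) =
      ∑ k : Fin L, (if Odd (symmDiff (μ k.castSucc) (μ k.succ)).card then (1 : ℤ) else 0) := by
    rw [Finset.sum_ite, Finset.sum_const_zero, add_zero, Finset.sum_const, nsmul_eq_mul, mul_one]
  have hsteps : ∑ k : Fin L, (if Odd (symmDiff (μ k.castSucc) (μ k.succ)).card then (1 : ℤ) else 0) ≤
      ∑ k : Fin L, (∑ e ∈ μ k.succ, Int.sign (lam e) - ∑ e ∈ μ k.castSucc, Int.sign (lam e)) :=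
    Finset.sum_le_sum fun k _ => psi_step lam hlam _ _ (hslope k) (hsmall k)
  -- telescoping via a ℕ-indexed copy of the chain
  let g : ℕ → ℤ := fun i =>
    if h : i ≤ L then ∑ e ∈ μ ⟨i, Nat.lt_succ_of_le h⟩, Int.sign (lam e) else 0
  have htel : ∑ k : Fin L, (∑ e ∈ μ k.succ, Int.sign (lam e) - ∑ e ∈ μ k.castSucc, Int.sign (lam e)) =
      g L - g 0 := by
    have hfun : ∀ k : Fin L,
        ∑ e ∈ μ k.succ, Int.sign (lam e) - ∑ e ∈ μ k.castSucc, Int.sign (lam e) = g (k + 1) - g k := by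
      intro k
      have hk1 : (k : ℕ) + 1 ≤ L := k.isLt
      have hk0 : (k : ℕ) ≤ L := k.isLt.le
      simp only [g, dif_pos hk1, dif_pos hk0]
      congr 2
    rw [Finset.sum_congr rfl fun k _ => hfun k]
    rw [Fin.sum_univ_eq_sum_range (fun i => g (i + 1) - g i) L, Finset.sum_range_sub]
  have hrange : g L - g 0 ≤ N := by
    simp only [g, dif_pos (le_refl L), dif_pos (Nat.zero_le L)]
    exact psi_sub_psi_le lam _ _
  have : ((Finset.univ.filter fun k : Fin L =>
      Odd (symmDiff (μ k.castSucc) (μ k.succ)).card).card : ℤ) ≤ N := by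
    rw [hcount]; linarith
  exact_mod_cast this

end Summit.ValiantsHypothesis.ValiantsHypothesis.Theorems.KPlusLogSqLaw.ResolvedSmallBlocks
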